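import Mathlib
import HarnessLib
import HarnessLib.Audit
import Summits.ValiantsHypothesis.ValiantsHypothesis.Theorems.LacunarySymmetroidMatrixDescartesZeroChangeFloorDictionary
import Summits.ValiantsHypothesis.ValiantsHypothesis.Theorems.LacunarySymmetroidMatrixDescartesTopBinomial
import Summits.ValiantsHypothesis.ValiantsHypothesis.Theorems.LacunarySymmetroidMatrixDescartesConstantFreeRow
import Summits.ValiantsHypothesis.ValiantsHypothesis.Theorems.LacunarySymmetroidMatrixDescartesMonomialRow

/-!
# ValiantsHypothesis / LacunarySymmetroid — crux `MatrixDescartes` (stmt-ValiantsHypothesis-18050, V1), LINE (A) «product_plus_one»: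
# the `ZeroChange` cells IN FLOOR CURRENCY (`Z₊(eulerNumerator d a 0)`, unfolded), via ✓ `card_posRoots_euler_bottom_eq_posCrit`

Companies on a support `d₀ < d₁ < d₂` whose row `0` is of sign type `(−, +, +)` — a `(+,−,−)` = T5 row up to the sign of the row, which does
not change the root set of the Euler numerator — and whose other rows are one-signed nonnegative (T1), i.e. companies of the floor
`OneChangeFloorK3` at the bottom coupling; `Z₊` = number of distinct positive roots of the unfolded `eulerNumerator d a 0`:
* `floor_binomialLead_le_one` — row `0` a BINOMIAL `(−, 0, +)`, any T1 company: `Z₊ ≤ 1` (✓ `binomialLeadAtMostOne`), every support;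
* `floor_topBinomial_le_two` — the T1 rows are top binomials `(+, 0, +)`: `Z₊ ≤ 2` (✓ `topBinomialBlockAtMostTwo`), every support;
* `floor_middleBinomial_le_one` — the T1 rows are bottom binomials `(+, +, 0)`: `Z₊ ≤ 1` (✓ `middleBinomialBlockAtMostOne`), every support;
* `floor_monomialRow_le_one` — row `1` is a top monomial `(0, 0, +)`, the rest T1 with positive bottom letter: `Z₊ ≤ 1` (✓ `monomialRowAtMostOne`);
* `floor_constantFreeRow_le_one` — row `1` has no bottom letter `(0, +, +)`, the rest T1 with positive bottom letter, ratio `d₂−d₀ ≤ (3+2√2)(d₁−d₀)`: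
  `Z₊ ≤ 1` (✓ `constantFreeRowAtMostOne`);
(and ✓ `floor_smallRatio_le_two` of `…ZeroChangeFloorDictionary`: any T1 company, ratio `≤ 2`: `Z₊ ≤ 2`).

HONEST FRAMING: bookkeeping corollaries (helper) so that the line owner can book these cells against the floor; `OneChangeFloorK3` (ALL one-change
companies, all ratios, linear bound) is NOT proved; `MatrixDescartes` OPEN; `VP ≠ VNP` is NOT proved.  No definitions, no named facts, no sorry.
-/

set_option linter.dupNamespace false

namespace Summit.ValiantsHypothesis.ValiantsHypothesis.Theorems.LacunarySymmetroidMatrixDescartes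

namespace ZeroChange

open Polynomial Finset

/-- Row `0` a binomial `(−, 0, +)`, the other rows T1 with positive bottom letter: `Z₊(eulerNumerator d a 0) ≤ 1`, every support. -/
theorem floor_binomialLead_le_one {m : ℕ} (d : Fin 3 → ℕ) (h01 : d 0 < d 1) (h12 : d 1 < d 2) (a : Fin (m + 1) → Fin 3 → ℝ)
    (hW : a 0 0 < 0 ∧ a 0 1 = 0 ∧ 0 < a 0 2) (hB : ∀ i : Fin m, 0 < a i.succ 0 ∧ 0 ≤ a i.succ 1 ∧ 0 ≤ a i.succ 2) :
    ((∑ j, (∑ l, C (a j l * ((d l : ℝ) - d 0)) * X ^ (d l)) * ∏ i ∈ Finset.univ.erase j, (∑ l, C (a i l) * X ^ (d l))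
        : ℝ[X]).roots.toFinset.filter (fun t => 0 < t)).card ≤ 1 := by
  rw [card_posRoots_euler_bottom_eq_posCrit d h01.le (h01.le.trans h12.le) a, Fin.prod_univ_succ, hW.2.1,
    show a 0 0 = -(-a 0 0) by ring]
  exact binomialLeadAtMostOne m (d 1 - d 0) (d 2 - d 0) (by omega) (by omega) (-a 0 0) (a 0 2)
    (fun i => a i.succ 0) (fun i => a i.succ 1) (fun i => a i.succ 2) (by linarith [hW.1]) hW.2.2 hB

/-- Row `0` of type `(−, +, +)`, the other rows top binomials `(+, 0, +)`: `Z₊(eulerNumerator d a 0) ≤ 2`, every support. -/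
theorem floor_topBinomial_le_two {m : ℕ} (d : Fin 3 → ℕ) (h01 : d 0 < d 1) (h12 : d 1 < d 2) (a : Fin (m + 1) → Fin 3 → ℝ)
    (hW : a 0 0 < 0 ∧ 0 ≤ a 0 1 ∧ 0 < a 0 2) (hB : ∀ i : Fin m, 0 < a i.succ 0 ∧ a i.succ 1 = 0 ∧ 0 < a i.succ 2) :
    ((∑ j, (∑ l, C (a j l * ((d l : ℝ) - d 0)) * X ^ (d l)) * ∏ i ∈ Finset.univ.erase j, (∑ l, C (a i l) * X ^ (d l))
        : ℝ[X]).roots.toFinset.filter (fun t => 0 < t)).card ≤ 2 := by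
  rw [card_posRoots_euler_bottom_eq_posCrit d h01.le (h01.le.trans h12.le) a, Fin.prod_univ_succ,
    show a 0 0 = -(-a 0 0) by ring,
    Finset.prod_congr rfl (fun i _ => by rw [(hB i).2.1] :
      ∀ i ∈ (univ : Finset (Fin m)), row (d 1 - d 0) (d 2 - d 0) (a i.succ 0) (a i.succ 1) (a i.succ 2)
        = row (d 1 - d 0) (d 2 - d 0) (a i.succ 0) 0 (a i.succ 2))]
  exact topBinomialBlockAtMostTwo m (d 1 - d 0) (d 2 - d 0) (by omega) (by omega) (-a 0 0) (a 0 1) (a 0 2)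
    (fun i => a i.succ 0) (fun i => a i.succ 2) (by linarith [hW.1]) hW.2.1 hW.2.2 (fun i => ⟨(hB i).1, (hB i).2.2⟩)

/-- Row `0` of type `(−, +, +)`, the other rows bottom binomials `(+, +, 0)`: `Z₊(eulerNumerator d a 0) ≤ 1`, every support. -/
theorem floor_middleBinomial_le_one {m : ℕ} (d : Fin 3 → ℕ) (h01 : d 0 < d 1) (h12 : d 1 < d 2) (a : Fin (m + 1) → Fin 3 → ℝ)
    (hW : a 0 0 < 0 ∧ 0 ≤ a 0 1 ∧ 0 < a 0 2) (hB : ∀ i : Fin m, 0 < a i.succ 0 ∧ 0 < a i.succ 1 ∧ a i.succ 2 = 0) :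
    ((∑ j, (∑ l, C (a j l * ((d l : ℝ) - d 0)) * X ^ (d l)) * ∏ i ∈ Finset.univ.erase j, (∑ l, C (a i l) * X ^ (d l))
        : ℝ[X]).roots.toFinset.filter (fun t => 0 < t)).card ≤ 1 := by
  rw [card_posRoots_euler_bottom_eq_posCrit d h01.le (h01.le.trans h12.le) a, Fin.prod_univ_succ,
    show a 0 0 = -(-a 0 0) by ring,
    Finset.prod_congr rfl (fun i _ => by rw [(hB i).2.2] :
      ∀ i ∈ (univ : Finset (Fin m)), row (d 1 - d 0) (d 2 - d 0) (a i.succ 0) (a i.succ 1) (a i.succ 2)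
        = row (d 1 - d 0) (d 2 - d 0) (a i.succ 0) (a i.succ 1) 0)]
  exact middleBinomialBlockAtMostOne m (d 1 - d 0) (d 2 - d 0) (by omega) (by omega) (-a 0 0) (a 0 1) (a 0 2)
    (fun i => a i.succ 0) (fun i => a i.succ 1) (by linarith [hW.1]) hW.2.1 hW.2.2 (fun i => ⟨(hB i).1, (hB i).2.1⟩)

/-- Row `0` of type `(−, +, +)`, row `1` a top monomial `(0, 0, +)`, the rest T1 with positive bottom letter: `Z₊(eulerNumerator d a 0) ≤ 1`. -/
theorem floor_monomialRow_le_one {m : ℕ} (d : Fin 3 → ℕ) (h01 : d 0 < d 1) (h12 : d 1 < d 2) (a : Fin (m + 2) → Fin 3 → ℝ)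
    (hW : a 0 0 < 0 ∧ 0 ≤ a 0 1 ∧ 0 < a 0 2) (hM : a 1 0 = 0 ∧ a 1 1 = 0 ∧ 0 < a 1 2)
    (hB : ∀ i : Fin m, 0 < a i.succ.succ 0 ∧ 0 ≤ a i.succ.succ 1 ∧ 0 ≤ a i.succ.succ 2) :
    ((∑ j, (∑ l, C (a j l * ((d l : ℝ) - d 0)) * X ^ (d l)) * ∏ i ∈ Finset.univ.erase j, (∑ l, C (a i l) * X ^ (d l))
        : ℝ[X]).roots.toFinset.filter (fun t => 0 < t)).card ≤ 1 := by
  rw [card_posRoots_euler_bottom_eq_posCrit d h01.le (h01.le.trans h12.le) a, Fin.prod_univ_succ, Fin.prod_univ_succ,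
    Fin.succ_zero_eq_one, show a 0 0 = -(-a 0 0) by ring]
  have hrow1 : row (d 1 - d 0) (d 2 - d 0) (a 1 0) (a 1 1) (a 1 2) = C (a 1 2) * X ^ (d 2 - d 0) := by
    rw [row, hM.1, hM.2.1]; simp
  have hΦ : row (d 1 - d 0) (d 2 - d 0) (-(-a 0 0)) (a 0 1) (a 0 2) *
      (row (d 1 - d 0) (d 2 - d 0) (a 1 0) (a 1 1) (a 1 2) *
        ∏ i : Fin m, row (d 1 - d 0) (d 2 - d 0) (a i.succ.succ 0) (a i.succ.succ 1) (a i.succ.succ 2))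
      = C (a 1 2) * (row (d 1 - d 0) (d 2 - d 0) (-(-a 0 0)) (a 0 1) (a 0 2) * X ^ (d 2 - d 0) *
        ∏ i : Fin m, row (d 1 - d 0) (d 2 - d 0) (a i.succ.succ 0) (a i.succ.succ 1) (a i.succ.succ 2)) := by
    rw [hrow1]; ring
  have hscale : ∀ (s : ℝ) (Φ : ℝ[X]), s ≠ 0 → posCrit (C s * Φ) = posCrit Φ := by
    intro s Φ hs
    rw [posCrit, posCrit, derivative_mul, derivative_C, zero_mul, zero_add, roots_C_mul _ hs]
  rw [hΦ, hscale _ _ hM.2.2.ne']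
  exact monomialRowAtMostOne m (d 1 - d 0) (d 2 - d 0) (by omega) (by omega) (-a 0 0) (a 0 1) (a 0 2)
    (fun i => a i.succ.succ 0) (fun i => a i.succ.succ 1) (fun i => a i.succ.succ 2) (by linarith [hW.1]) hW.2.1 hW.2.2 hB

/-- Row `0` of type `(−, +, +)`, row `1` without bottom letter `(0, +, +)`, the rest T1 with positive bottom letter, ratio
`d₂ − d₀ ≤ (3 + 2√2)(d₁ − d₀)`: `Z₊(eulerNumerator d a 0) ≤ 1`. -/
theorem floor_constantFreeRow_le_one {m : ℕ} (d : Fin 3 → ℕ) (h01 : d 0 < d 1) (h12 : d 1 < d 2)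
    (hratio : ((d 2 - d 0 : ℕ) : ℝ) ≤ (3 + 2 * Real.sqrt 2) * ((d 1 - d 0 : ℕ) : ℝ)) (a : Fin (m + 2) → Fin 3 → ℝ)
    (hW : a 0 0 < 0 ∧ 0 ≤ a 0 1 ∧ 0 < a 0 2) (hF : a 1 0 = 0 ∧ 0 ≤ a 1 1 ∧ 0 ≤ a 1 2 ∧ 0 < a 1 1 + a 1 2)
    (hB : ∀ i : Fin m, 0 < a i.succ.succ 0 ∧ 0 ≤ a i.succ.succ 1 ∧ 0 ≤ a i.succ.succ 2) :
    ((∑ j, (∑ l, C (a j l * ((d l : ℝ) - d 0)) * X ^ (d l)) * ∏ i ∈ Finset.univ.erase j, (∑ l, C (a i l) * X ^ (d l))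
        : ℝ[X]).roots.toFinset.filter (fun t => 0 < t)).card ≤ 1 := by
  rw [card_posRoots_euler_bottom_eq_posCrit d h01.le (h01.le.trans h12.le) a, Fin.prod_univ_succ, Fin.prod_univ_succ,
    Fin.succ_zero_eq_one, show a 0 0 = -(-a 0 0) by ring, hF.1, ← mul_assoc]
  exact constantFreeRowAtMostOne m (d 1 - d 0) (d 2 - d 0) (by omega) (by omega) hratio (-a 0 0) (a 0 1) (a 0 2)
    (a 1 1) (a 1 2) (fun i => a i.succ.succ 0) (fun i => a i.succ.succ 1) (fun i => a i.succ.succ 2)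
    (by linarith [hW.1]) hW.2.1 hW.2.2 hF.2.1 hF.2.2.1 hF.2.2.2 hB

end ZeroChange

end Summit.ValiantsHypothesis.ValiantsHypothesis.Theorems.LacunarySymmetroidMatrixDescartes
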